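import Summits.NavierStokesRegularity.NavierStokesRegularity.Theorems.PeepholeVorticityDoorAssemblyInt
import Summits.NavierStokesRegularity.NavierStokesRegularity.Theorems.PeepholeVorticityDoorFramePressure
import Summits.NavierStokesRegularity.NavierStokesRegularity.Theorems.PeepholeVorticityDoorFrameTools

/-!
# PeepholeVorticityDoorFrame — door S29 «PeepholeVorticityDoor», FILE 4b of the LINE DOC: the frame transfer
# `PVPeepholeRegularityInt → TargetPeepholeVorticity` and the door modulo the Carleman stub (nsreg-p6 g15, DIRECTOR-NS #106 (1)(b))

The transfer is the parabolic change of variables of `PeepholeVorticityDoorFrameTools` with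
`β = min(T/2, ρ²/(4(ν+1)))` (so that `[T−β, T) × B(x₀,λ) ⊆ Q_ρ(x₀,T) ∩ {t ≥ T/2}`, `λ = √(νβ) < ρ`) and `x₁ ∈ B(x₀, λ)` the
class-uniform gauge point of `exists_pressure_gauge_point` (FILE 4a):
* `(v, q)` is classical on `[−1,0) × B₁`; (1.15) with `C_u = |M|/ν + 1`;
* `∫∫_{(−1,0)×B₁} |q|^{3/2} ≤ B_p(ν, M, ρ, E₀, T)` (change of variables and the gauge point) and `∫∫_{(−1,0)×B₁} |∇v|² < ∞`
  (the dissipation level `E₀/ν`, `StableStrataDoorClassSlabLevels.lintegral_slab_frobeniusNormSq_fderiv_le`);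
* the peephole: `(−s̄) curl v(s̄) z = (T−t̄) ω(t̄, x₀ + λz)`, `t̄ = T + βs̄`, so the door's peephole ball `B(y₀, r)` at `t̄` is
  the PV peephole ball with `(y₀', r') = (y₀/√ν, r/√ν)` at `s̄`;
* the lateness `t⋆ = T − e^{−s₀(B_p)} β` — `β`, `B_p` are CLASS constants, so the door's quantifier shape
  `∃ ε ∀ (T, ρ, E₀) ∃ t⋆ ∀ u` is met — and the pull-back of the bounded cylinder (`isBackwardBoundedAt_of_pv_bound`).
Final: `targetPeepholeVorticity_of_peepholeToCore : PeepholeToCore → TargetPeepholeVorticity` and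
`targetPeepholeVorticity_of_explicit : PeepholeToCoreExplicit → TargetPeepholeVorticity` — DOOR S29 PROVED MODULO STUB 1
(`PeepholeToCoreExplicit`, the Carleman transfer of FILE 2) ONLY.
-/

noncomputable section

set_option linter.dupNamespace false

namespace Summit.NavierStokesRegularity.NavierStokesRegularity.Theorems.PeepholeVorticityDoor

open MeasureTheory Set Function Filter Topology TopologicalSpace Metric
open scoped NNReal ENNReal
open Literature.Analysis Literature.Analysis.FluidPDE
open Summit.NavierStokesRegularity.NavierStokesRegularity.Theorems.StableStrataDoorDefs (physWindowField)
open Summit.NavierStokesRegularity.NavierStokesRegularity.Theorems.StableStrataDoorClassSlabLevels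
  (lintegral_slab_frobeniusNormSq_fderiv_le)

-- nested operator types
set_option maxSynthPendingDepth 3

section Door

/-- **S29 stub 3 (frame transfer), integral form: `PVPeepholeRegularityInt → TargetPeepholeVorticity`.**  See the file
header for the change of frame; the lateness threshold is `t⋆ = T − e^{−s₀(B_p)} β` with `β = β(ν, T, ρ)` and
`B_p = B_p(ν, M, ρ, E₀, T)` CLASS constants, so the door's quantifier shape (`∃ ε ∀ (T, ρ, E₀) ∃ t⋆ ∀ u`) is met. -/
theorem targetPeepholeVorticity_of_pvInt (h : PVPeepholeRegularityInt) : TargetPeepholeVorticity := by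
  intro ν hν M y₀ r hr
  -- the Pineau–Vicol-frame constants of `(ν, M, y₀, r)`
  set Cu : ℝ := |M| / ν + 1 with hCu_def
  have hCu : 0 < Cu := by positivity
  have hMCu : M / ν ≤ Cu := by
    have h1 : M / ν ≤ |M| / ν := div_le_div_of_nonneg_right (le_abs_self M) hν.le
    linarith
  have hsν : 0 < Real.sqrt ν := Real.sqrt_pos.2 hν
  set y₀' : EuclideanSpace ℝ (Fin 3) := (Real.sqrt ν)⁻¹ • y₀ with hy₀'
  set r' : ℝ := r / Real.sqrt ν with hr'_def
  have hr' : 0 < r' := div_pos hr hsν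
  obtain ⟨ε, hε, -, Hd⟩ := h Cu hCu y₀' r' hr'
  refine ⟨ε, hε, fun T ρ E₀ hT hρ => ?_⟩
  -- the scale `β = λ²/ν`
  set β : ℝ := min (T / 2) (ρ ^ 2 / (4 * (ν + 1))) with hβ_def
  have hβ : 0 < β := lt_min (by positivity) (by positivity)
  have hβT2 : β ≤ T / 2 := min_le_left _ _
  have hβT : β < T := by linarith
  have hβρ : β ≤ ρ ^ 2 / (4 * (ν + 1)) := min_le_right _ _
  have hρ4 : ρ ^ 2 / (4 * (ν + 1)) ≤ ρ ^ 2 / 4 :=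
    div_le_div_of_nonneg_left (sq_nonneg ρ) (by norm_num) (by linarith)
  have hβρ' : β < ρ ^ 2 := by nlinarith
  set lam : ℝ := Real.sqrt (ν * β) with hlam_def
  have hlam : 0 < lam := Real.sqrt_pos.2 (by positivity)
  have hlam2 : lam ^ 2 = ν * β := Real.sq_sqrt (by positivity)
  have hlamρ : lam < ρ := by
    have h1 : ν * (ρ ^ 2 / (4 * (ν + 1))) ≤ ρ ^ 2 / 4 := by
      rw [mul_div_assoc', div_le_div_iff₀ (by positivity) (by positivity)]
      nlinarith [sq_nonneg ρ]
    have h2 : lam ^ 2 < ρ ^ 2 := by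
      have : ν * β ≤ ν * (ρ ^ 2 / (4 * (ν + 1))) := by gcongr
      nlinarith
    exact lt_of_pow_lt_pow_left₀ 2 hρ.le h2
  have hα : 0 < lam / ν := by positivity
  -- the class pressure constant
  set P : ℝ≥0∞ := 2 ^ (3 / 2 : ℝ) * ((steinConstThreeHalves : ℝ≥0∞) ^ (3 / 2 : ℝ) *
        (ENNReal.ofReal (2 * E₀) ^ (3 / 4 : ℝ) *
          ((SNormLESNormFDerivOfEqConst (EuclideanSpace ℝ (Fin 3))
              (volume : Measure (EuclideanSpace ℝ (Fin 3))) 2 : ℝ≥0∞) ^ (3 / 2 : ℝ) *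
            (ENNReal.ofReal T + ENNReal.ofReal (E₀ / ν))))) with hP_def
  have hPt : P ≠ ⊤ := by
    have h1 : (2 : ℝ≥0∞) ^ (3 / 2 : ℝ) ≠ ⊤ := ENNReal.rpow_ne_top_of_nonneg (by norm_num) ENNReal.ofNat_ne_top
    have h2 : (steinConstThreeHalves : ℝ≥0∞) ^ (3 / 2 : ℝ) ≠ ⊤ :=
      ENNReal.rpow_ne_top_of_nonneg (by norm_num) ENNReal.coe_ne_top
    have h3 : ENNReal.ofReal (2 * E₀) ^ (3 / 4 : ℝ) ≠ ⊤ :=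
      ENNReal.rpow_ne_top_of_nonneg (by norm_num) ENNReal.ofReal_ne_top
    have h4 : ((SNormLESNormFDerivOfEqConst (EuclideanSpace ℝ (Fin 3))
        (volume : Measure (EuclideanSpace ℝ (Fin 3))) 2 : ℝ≥0∞)) ^ (3 / 2 : ℝ) ≠ ⊤ :=
      ENNReal.rpow_ne_top_of_nonneg (by norm_num) ENNReal.coe_ne_top
    have h5 : ENNReal.ofReal T + ENNReal.ofReal (E₀ / ν) ≠ ⊤ :=
      ENNReal.add_ne_top.2 ⟨ENNReal.ofReal_ne_top, ENNReal.ofReal_ne_top⟩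
    exact ENNReal.mul_ne_top h1 (ENNReal.mul_ne_top h2 (ENNReal.mul_ne_top h3 (ENNReal.mul_ne_top h4 h5)))
  set K : ℝ≥0∞ := ENNReal.ofReal (β * lam ^ 3)⁻¹ * (‖(lam / ν) ^ 2‖ₑ ^ (3 / 2 : ℝ) * P) with hK_def
  have hKt : K ≠ ⊤ :=
    ENNReal.mul_ne_top ENNReal.ofReal_ne_top (ENNReal.mul_ne_top
      (ENNReal.rpow_ne_top_of_nonneg (by norm_num) enorm_ne_top) hPt)
  obtain ⟨s₀, -, Hs⟩ := Hd K.toNNReal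
  have hexp : 0 < Real.exp (-s₀) := Real.exp_pos _
  refine ⟨T - Real.exp (-s₀) * β, by nlinarith, ?_⟩
  intro u p hsol hLH _hdec hE x₀ hM tb htb hpeep
  -- the gauge point and the Pineau–Vicol pair
  obtain ⟨x₁, -, hx₁⟩ := exists_pressure_gauge_point hν hT hsol hLH hE (a := T - β) (by linarith) x₀ hlam
  set v : ℝ → EuclideanSpace ℝ (Fin 3) → EuclideanSpace ℝ (Fin 3) := (lam / ν) • stPull β lam T x₀ u with hv_def
  set q : ℝ → EuclideanSpace ℝ (Fin 3) → ℝ :=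
    (lam / ν) ^ 2 • stPull β lam T x₀ (fun t x => p t x - p t x₁) with hq_def
  have hreg : IsClassicalNSSolutionOnRegion
      (Ico (-1 : ℝ) 0 ×ˢ ball (0 : EuclideanSpace ℝ (Fin 3)) 1) 1 0 v q :=
    pvFrame_isClassical hν hsol hβ hβT x₀ x₁
  -- (1.15) with `C_u = |M|/ν + 1`
  have hI : ∀ s ∈ Ico (-1 : ℝ) 0, ∀ z ∈ ball (0 : EuclideanSpace ℝ (Fin 3)) 1,
      ‖v s z‖ ≤ Cu / (Real.sqrt (-s) + ‖z‖) :=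
    pv_typeI_transfer hν hβT hβρ' hlam hlam2 hlamρ hMCu hM
  -- the pressure level `B_p`
  have hP : ∫⁻ w in Ioo (-1 : ℝ) 0 ×ˢ ball (0 : EuclideanSpace ℝ (Fin 3)) 1,
      ‖q w.1 w.2‖ₑ ^ (3 / 2 : ℝ) ≤ (K.toNNReal : ℝ≥0∞) := by
    rw [ENNReal.coe_toNNReal hKt, hK_def, hq_def]
    refine (lintegral_pv_pressure_le hβ hlam (lam / ν) T x₀ x₁ p).trans ?_
    exact mul_le_mul_right (mul_le_mul_right hx₁ _) _
  -- the dissipation level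
  have hG : ∫⁻ w in Ioo (-1 : ℝ) 0 ×ˢ ball (0 : EuclideanSpace ℝ (Fin 3)) 1,
      ENNReal.ofReal (frobeniusNormSq (fderiv ℝ (v w.1) w.2)) < ⊤ := by
    rw [hv_def, lintegral_pv_gradient_eq hβ hlam (lam / ν) T x₀ u]
    refine ENNReal.mul_lt_top ENNReal.ofReal_lt_top (ENNReal.mul_lt_top ENNReal.ofReal_lt_top ?_)
    have hsub : Ioo (T - β) T ×ˢ ball x₀ lam ⊆ Ioo 0 T ×ˢ (univ : Set (EuclideanSpace ℝ (Fin 3))) :=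
      prod_mono (Ioo_subset_Ioo_left (show (0 : ℝ) ≤ T - β by linarith)) (subset_univ _)
    refine lt_of_le_of_lt (lintegral_mono_set hsub) ?_
    exact lt_of_le_of_lt (lintegral_slab_frobeniusNormSq_fderiv_le hν hT hsol hLH hE) ENNReal.ofReal_lt_top
  -- the slice time and the peephole in the Pineau–Vicol frame
  have htbT : tb < T := htb.2
  set sb : ℝ := (tb - T) / β with hsb_def
  have hsb0 : sb < 0 := div_neg_of_neg_of_pos (by linarith) hβ
  have hsb1 : -Real.exp (-s₀) < sb := by
    rw [hsb_def, lt_div_iff₀ hβ]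
    linarith [htb.1]
  have htb_eq : T + β * sb = tb := by
    rw [hsb_def, mul_div_cancel₀ _ hβ.ne']
    ring
  have hnegs : -sb = (T - tb) / β := by rw [hsb_def]; ring
  set a : ℝ := Real.sqrt (T - tb) with ha_def
  have ha : 0 < a := Real.sqrt_pos.2 (by linarith)
  have hsqs : Real.sqrt (-sb) = a / Real.sqrt β := by rw [hnegs, Real.sqrt_div' _ hβ.le]
  have hsβ : 0 < Real.sqrt β := Real.sqrt_pos.2 hβ
  have hlam_eq : lam = Real.sqrt ν * Real.sqrt β := by rw [hlam_def, Real.sqrt_mul hν.le]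
  have hpeep' : ∀ z ∈ ball (Real.sqrt (-sb) • y₀') (Real.sqrt (-sb) * r'), (-sb) * ‖curl (v sb) z‖ ≤ ε := by
    intro z hz
    -- the corresponding door point `y = (λ/a) z`
    have hy : (lam / a) • z ∈ ball y₀ r := by
      rw [mem_ball, dist_eq_norm] at hz ⊢
      have hcen : Real.sqrt (-sb) • y₀' = (a / lam) • y₀ := by
        rw [hsqs, hy₀', smul_smul, hlam_eq]
        congr 1
        field_simp
      have hrad : Real.sqrt (-sb) * r' = (a / lam) * r := by
        rw [hsqs, hr'_def, hlam_eq]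
        field_simp
      rw [hcen, hrad] at hz
      have h1 : (lam / a) • z - y₀ = (lam / a) • (z - (a / lam) • y₀) := by
        rw [smul_sub, smul_smul, show lam / a * (a / lam) = 1 by field_simp, one_smul]
      rw [h1, norm_smul, Real.norm_of_nonneg (by positivity)]
      calc lam / a * ‖z - (a / lam) • y₀‖ < lam / a * (a / lam * r) := by gcongr
        _ = r := by field_simp
    have key := hpeep _ hy
    rw [norm_curl_physWindowField htbT.le] at key
    have hay : a • ((lam / a) • z) = lam • z := by
      rw [smul_smul, show a * (lam / a) = lam by field_simp]
    rw [hay] at key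
    have hvs : v sb = fun z => (lam / ν) • u tb (x₀ + lam • z) := by
      funext z
      rw [hv_def, smul_stPull_apply, htb_eq]
    rw [hvs, curl_pv_slice, norm_smul, Real.norm_of_nonneg (by positivity)]
    have hll : lam / ν * lam = β := by
      rw [div_mul_eq_mul_div, ← pow_two, hlam2]
      field_simp
    have hcoef : -sb * (lam / ν * lam) = T - tb := by
      rw [hll, hnegs, div_mul_cancel₀ _ hβ.ne']
    rw [← mul_assoc, hcoef]
    exact key
  -- Theorem-1.9-type conclusion in the Pineau–Vicol frame, pulled back to `Q_{r₀}(x₀, T)`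
  obtain ⟨ϱ, hϱ, B, hB⟩ := Hs v q hreg hI hP hG sb hsb1 hsb0 hpeep'
  exact isBackwardBoundedAt_of_pv_bound hν hβ hlam hϱ hB

/-- **DOOR S29 MODULO hB′**: the peephole-to-core transfer alone gives the door (assembly FILE 3′ + frame FILE 4). -/
theorem targetPeepholeVorticity_of_peepholeToCore (hB : PeepholeToCore) : TargetPeepholeVorticity :=
  targetPeepholeVorticity_of_pvInt (pvPeepholeRegularityInt_of_peepholeToCore hB)

/-- **DOOR S29 MODULO STUB 1** (`PeepholeToCoreExplicit`, the Carleman transfer of FILE 2 — the one remaining input). -/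
theorem targetPeepholeVorticity_of_explicit (h₁ : PeepholeToCoreExplicit) : TargetPeepholeVorticity :=
  targetPeepholeVorticity_of_int' h₁ targetPeepholeVorticity_of_pvInt

end Door

end Summit.NavierStokesRegularity.NavierStokesRegularity.Theorems.PeepholeVorticityDoor

end
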